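import Mathlib.NumberTheory.Cyclotomic.Gal
import Mathlib.NumberTheory.NumberField.Cyclotomic.Basic
import Mathlib.FieldTheory.Finite.Basic
import Mathlib.RingTheory.RootsOfUnity.Lemmas
import Mathlib.LinearAlgebra.FreeModule.IdealQuotient
import Literature.NumberTheory.Automorphic.GaloisActionPlaces
import HarnessLib

/-!
# The decomposition group of an unramified prime in `ℚ(ζ_m)/ℚ` consists of powers of `σ_p`

Topic `NumberTheory/GaloisRepresentations` (companion of `CyclotomicLevels`, `ModNCyclotomicCharacter`;
uses the Galois action on places of `Literature.NumberTheory.Automorphic.GaloisActionPlaces`).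
`Proofs` file: theorems only, no definitions, no named facts.

* `CyclotomicField.autEquivPow_eq_pow_of_smul_eq` — **for `p ∤ m` and a place `w` of `L = ℚ(ζ_m)`
  above `p`, every `γ ∈ Gal(L/ℚ)` with `γ • w = w` acts on `ζ_m` as `ζ_m ↦ ζ_m^{p^i}` for some `i`**,
  i.e. `γ = σ_p^i` with `σ_p : ζ_m ↦ ζ_m^p` the Frobenius of `p` (Washington, *Introduction to
  Cyclotomic Fields*, Thm. 2.13: for `p ∤ m` the decomposition group of `p` in `Gal(ℚ(ζ_m)/ℚ) ≅ (ℤ/m)ˣ`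
  is the cyclic group generated by `p mod m`; this file proves the inclusion `D(w) ⊆ ⟨σ_p⟩`).
  Proof: `γ` induces an automorphism of the finite residue field `k(w) = 𝓞_L/w` of characteristic
  `p`, which is a power `x ↦ x^{p^i}` of the Frobenius (Mathlib
  `FiniteField.bijective_frobeniusAlgEquivOfAlgebraic_pow`); so `ζ^{χ(γ)} ≡ ζ^{p^i} (mod w)`; and
  `ζ mod w` is still a PRIMITIVE `m`-th root of unity because `∏_{0<j<m} (1 − ζ^j) = m` is prime to
  `p` (Mathlib `IsPrimitiveRoot.prod_one_sub_pow_eq_order`), whence `χ(γ) ≡ p^i (mod m)`.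

Consumer: the `D`-equivariance clause (GAL₀) of a dual-exponential value datum defined through one
completion of the level field (`Summit.…KimAtThreeFineKatoValueEquivariance`, cell `bsd-addord`): it
reduces «`τ̃` fixes the place `w₀`» to «`τ` lies in the decomposition group `D_{𝔓₀} · Gal(ℚ̄/ℚ(μ_m))`»
once an arithmetic Frobenius in `D_{𝔓₀}` is available (`ModNCyclotomicCharacter`).

## References
* [Washington1997] L. C. Washington, *Introduction to Cyclotomic Fields*, 2nd ed. (1997), Thm. 2.13
  (and Lemma 2.12).
* [NeukirchANT1999] J. Neukirch, *Algebraic Number Theory* (1999), Ch. I (10.3)–(10.5) (decomposition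
  of primes in cyclotomic fields).
-/

noncomputable section

open scoped NumberField
open NumberField IsDedekindDomain Polynomial Literature.NumberTheory.Automorphic

namespace Literature.NumberTheory.GaloisRepresentations

variable {m : ℕ} [NeZero m]

set_option backward.isDefEq.respectTransparency false in
/-- **The reduction of `ζ_m` modulo a prime `w ∤ m` of `𝓞_{ℚ(ζ_m)}` is a primitive `m`-th root of
unity of the residue field** (`∏_{0<j<m} (1 − ζ^j) = m ∉ w`). [cite: Washington1997, Lemma 2.12] -/
theorem CyclotomicField.isPrimitiveRoot_mk_toInteger
    (w : HeightOneSpectrum (𝓞 (CyclotomicField m ℚ)))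
    (hmw : (m : 𝓞 (CyclotomicField m ℚ)) ∉ w.asIdeal) :
    IsPrimitiveRoot (Ideal.Quotient.mk w.asIdeal
      (IsCyclotomicExtension.zeta_spec m ℚ (CyclotomicField m ℚ)).toInteger) m := by
  set ζi := (IsCyclotomicExtension.zeta_spec m ℚ (CyclotomicField m ℚ)).toInteger with hζi
  have hζ : IsPrimitiveRoot ζi m :=
    (IsCyclotomicExtension.zeta_spec m ℚ (CyclotomicField m ℚ)).toInteger_isPrimitiveRoot
  refine IsPrimitiveRoot.mk_of_lt _ (NeZero.pos m) (by rw [← map_pow, hζ.pow_eq_one, map_one]) ?_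
  intro l hl hlm hone
  -- `1 - ζ^l ∈ w`, but it divides `∏_{0<j<m} (1 - ζ^j) = m ∉ w`
  have hmem : 1 - ζi ^ l ∈ w.asIdeal := by
    rw [← Ideal.Quotient.eq_zero_iff_mem, map_sub, map_one, map_pow, hone, sub_self]
  obtain ⟨n, rfl⟩ : ∃ n, m = n + 1 := Nat.exists_eq_succ_of_ne_zero (NeZero.ne m)
  have hprod := hζ.prod_one_sub_pow_eq_order
  have hdvd : (1 - ζi ^ l) ∣ ∏ k ∈ Finset.range n, (1 - ζi ^ (k + 1)) := by
    obtain ⟨l', rfl⟩ : ∃ l', l = l' + 1 := Nat.exists_eq_succ_of_ne_zero hl.ne'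
    exact Finset.dvd_prod_of_mem (fun k => 1 - ζi ^ (k + 1)) (Finset.mem_range.mpr (by omega))
  apply hmw
  rw [Nat.cast_succ, ← hprod]
  exact Ideal.mem_of_dvd _ hdvd hmem

set_option backward.isDefEq.respectTransparency false in
/-- **Washington, Thm. 2.13 (the inclusion `D(w ∣ p) ⊆ ⟨σ_p⟩`).**  Let `p ∤ m`, `w` a place of
`L = ℚ(ζ_m)` above `p`, and `γ ∈ Gal(L/ℚ)` with `γ • w = w`.  Then the exponent `χ(γ) ∈ (ℤ/m)ˣ` of
`γ` (`γ ζ = ζ^{χ(γ)}`, Mathlib `IsCyclotomicExtension.autEquivPow`) is a power of `p`: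
`χ(γ) = p^i` in `ℤ/m` for some `i` — i.e. `γ = σ_p^i`.  (The induced automorphism of the finite
residue field `𝓞_L/w` is a Frobenius power; `ζ mod w` is a primitive `m`-th root of unity.)
[cite: Washington1997, Thm. 2.13] -/
theorem CyclotomicField.autEquivPow_eq_pow_of_smul_eq {p : ℕ} [hp : Fact p.Prime] (hpm : ¬ p ∣ m)
    (w : HeightOneSpectrum (𝓞 (CyclotomicField m ℚ)))
    (hw : (p : 𝓞 (CyclotomicField m ℚ)) ∈ w.asIdeal)
    (γ : CyclotomicField m ℚ ≃ₐ[ℚ] CyclotomicField m ℚ) (hγ : γ • w = w) :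
    ∃ i : ℕ, ((IsCyclotomicExtension.autEquivPow (CyclotomicField m ℚ)
        (cyclotomic.irreducible_rat (NeZero.pos m)) γ : (ZMod m)ˣ) : ZMod m) = (p : ZMod m) ^ i := by
  set I := w.asIdeal with hI
  haveI : I.IsMaximal := w.isMaximal
  letI : Field (𝓞 (CyclotomicField m ℚ) ⧸ I) := Ideal.Quotient.field I
  haveI : Finite (𝓞 (CyclotomicField m ℚ) ⧸ I) := Ideal.finiteQuotientOfFreeOfNeBot I w.ne_bot
  -- the residue field has characteristic `p`
  have hpk : ((p : ℕ) : 𝓞 (CyclotomicField m ℚ) ⧸ I) = 0 := by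
    rw [← map_natCast (Ideal.Quotient.mk I), Ideal.Quotient.eq_zero_iff_mem]
    exact hw
  haveI : CharP (𝓞 (CyclotomicField m ℚ) ⧸ I) p := (CharP.charP_iff_prime_eq_zero hp.out).mpr hpk
  letI : Algebra (ZMod p) (𝓞 (CyclotomicField m ℚ) ⧸ I) := ZMod.algebra _ p
  -- the automorphism of the residue field induced by `γ`
  let γk : 𝓞 (CyclotomicField m ℚ) ⧸ I ≃+* 𝓞 (CyclotomicField m ℚ) ⧸ I :=
    (HeightOneSpectrum.residueEquivOfSMul γ w).trans (Ideal.quotEquivOfEq (congrArg HeightOneSpectrum.asIdeal hγ))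
  have hγk : ∀ x : 𝓞 (CyclotomicField m ℚ), γk (Ideal.Quotient.mk I x) = Ideal.Quotient.mk I (γ • x) := fun x => rfl
  let γa : (𝓞 (CyclotomicField m ℚ) ⧸ I) ≃ₐ[ZMod p] (𝓞 (CyclotomicField m ℚ) ⧸ I) :=
    AlgEquiv.ofRingEquiv (f := γk) fun x =>
      congrFun (congrArg DFunLike.coe
        (Subsingleton.elim (γk.toRingHom.comp (algebraMap (ZMod p) (𝓞 (CyclotomicField m ℚ) ⧸ I)))
          (algebraMap (ZMod p) (𝓞 (CyclotomicField m ℚ) ⧸ I)))) x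
  -- it is a power of the Frobenius
  obtain ⟨⟨n, hnlt⟩, hn⟩ :=
    (FiniteField.bijective_frobeniusAlgEquivOfAlgebraic_pow (ZMod p) (𝓞 (CyclotomicField m ℚ) ⧸ I)).2 γa
  have hfrob : ∀ x : 𝓞 (CyclotomicField m ℚ) ⧸ I, γk x = x ^ (p ^ n) := fun x => by
    have h1 := congrFun (congrArg (fun e : (𝓞 (CyclotomicField m ℚ) ⧸ I) ≃ₐ[ZMod p] (𝓞 (CyclotomicField m ℚ) ⧸ I) => (e : 𝓞 (CyclotomicField m ℚ) ⧸ I → 𝓞 (CyclotomicField m ℚ) ⧸ I)) hn) x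
    simp only [AlgEquiv.coe_pow, FiniteField.coe_frobeniusAlgEquivOfAlgebraic_iterate, ZMod.card] at h1
    exact h1.symm
  -- apply to `ζ`: `γ ζ = ζ ^ b`, `b = χ(γ)`
  have hζ := IsCyclotomicExtension.zeta_spec m ℚ (CyclotomicField m ℚ)
  change ∃ i : ℕ, ((hζ.autToPow ℚ γ : (ZMod m)ˣ) : ZMod m) = (p : ZMod m) ^ i
  set b : (ZMod m)ˣ := hζ.autToPow ℚ γ with hb
  have hγζ : γ (IsCyclotomicExtension.zeta m ℚ (CyclotomicField m ℚ)) = IsCyclotomicExtension.zeta m ℚ (CyclotomicField m ℚ) ^ (b : ZMod m).val :=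
    (hζ.autToPow_spec ℚ γ).symm
  have hsmul : γ • hζ.toInteger = hζ.toInteger ^ (b : ZMod m).val := by
    apply RingOfIntegers.ext
    calc ((γ • hζ.toInteger : 𝓞 (CyclotomicField m ℚ)) : CyclotomicField m ℚ) = γ (hζ.toInteger : CyclotomicField m ℚ) := RingOfIntegers.coe_algEquiv_smul ℚ γ _
      _ = IsCyclotomicExtension.zeta m ℚ (CyclotomicField m ℚ) ^ (b : ZMod m).val := hγζ
      _ = ((hζ.toInteger ^ (b : ZMod m).val : 𝓞 (CyclotomicField m ℚ)) : CyclotomicField m ℚ) := by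
        rw [RingOfIntegers.coe_eq_algebraMap, map_pow]; rfl
  have hk : (Ideal.Quotient.mk I hζ.toInteger) ^ (b : ZMod m).val =
      (Ideal.Quotient.mk I hζ.toInteger) ^ (p ^ n) := by
    rw [← hfrob, hγk, hsmul, map_pow]
  -- `ζ mod w` is primitive (as `m ∉ w`): exponents agree mod `m`
  have hmw : (m : 𝓞 (CyclotomicField m ℚ)) ∉ I := fun hmI => by
    have hcop : Nat.Coprime p m := (Nat.Prime.coprime_iff_not_dvd hp.out).mpr hpm
    obtain ⟨u, v, huv⟩ : IsCoprime (p : ℤ) (m : ℤ) := Nat.isCoprime_iff_coprime.mpr hcop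
    apply w.isMaximal.ne_top
    rw [Ideal.eq_top_iff_one]
    have h1 : (1 : 𝓞 (CyclotomicField m ℚ)) = (u : 𝓞 (CyclotomicField m ℚ)) * (p : 𝓞 (CyclotomicField m ℚ)) + (v : 𝓞 (CyclotomicField m ℚ)) * (m : 𝓞 (CyclotomicField m ℚ)) := by
      have := congrArg (Int.cast : ℤ → 𝓞 (CyclotomicField m ℚ)) huv
      push_cast at this
      exact this.symm
    rw [h1]
    exact I.add_mem (I.mul_mem_left _ hw) (I.mul_mem_left _ hmI)
  have hprim := CyclotomicField.isPrimitiveRoot_mk_toInteger w hmw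
  refine ⟨n, ?_⟩
  have hmod : (b : ZMod m).val ≡ p ^ n [MOD m] := by
    refine hprim.pow_inj (Nat.mod_lt _ (NeZero.pos m)) (Nat.mod_lt _ (NeZero.pos m)) ?_
    have hmodpow : ∀ a : ℕ, (Ideal.Quotient.mk w.asIdeal hζ.toInteger) ^ (a % m) =
        (Ideal.Quotient.mk w.asIdeal hζ.toInteger) ^ a := fun a => by
      conv_rhs => rw [← Nat.mod_add_div a m]
      rw [pow_add, pow_mul, hprim.pow_eq_one, one_pow, mul_one]
    rw [hmodpow, hmodpow]
    exact hk
  rw [← ZMod.natCast_zmod_val (b : ZMod m), (ZMod.natCast_eq_natCast_iff _ _ _).mpr hmod, Nat.cast_pow]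

end Literature.NumberTheory.GaloisRepresentations

end
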